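import Summits.ResolutionOfSingularities.ResolutionOfSingularities.Theses.PAlteration
import Literature.AlgebraicGeometry.Resolution.AlterationsResolution
import HarnessLib

/-!
# Route pAlteration — the crux `PalterationThesis` (item stmt-ResolutionOfSingularities-0552):
# glue and sandwich

`PalterationThesis` is, prime by prime, the conjunction `PIAlt_p ∧ PICover_p` of the route's two
other cruxes `Pialt` (stmt-0555, the Abramovich–Oort conjecture, Temkin 2013 Conj. 1.3.1) and
`Picover` (stmt-0554, resolution of finite radicial covers of regular varieties, the "inseparable
case"). This file records, sorry-free:

* the GLUE `Pialt → Picover → PalterationThesis` and the two projections, so that the item is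
  derived from stmt-0555 and stmt-0554 (`palterationThesis_iff_pialt_and_picover`);
* the SANDWICH from above: the summit statement `ResolutionOfSingularities` implies each conjunct
  and hence the thesis (`palterationThesis_of_resolutionOfSingularities`), prime by prime
  (`pialtAt_of_resolutionInChar`, `picoverAt_of_resolutionInChar`). Together with the route's
  deciding theorem `closes` this certifies that the crux is exactly summit-hard: it cannot be
  refuted unless resolution of singularities in positive characteristic fails.

Sources: Temkin 2013 (arXiv:0804.1554v3) §1 p. 3 (i) ⊂ (iii) (a desingularisation is a purely
inseparable alteration; in tree as
`Literature.AlgebraicGeometry.Resolution.IsResolution.isPurelyInseparableAlteration`); the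
radicial-cover half is immediate from the definitions (a finite cover of a separated finite-type
`k`-scheme is a separated finite-type `k`-scheme).
-/

set_option linter.dupNamespace false -- mandated namespace of this single-conjunct summit

namespace Summit.ResolutionOfSingularities.ResolutionOfSingularities.Theorems

open CategoryTheory AlgebraicGeometry
open Literature.AlgebraicGeometry.Resolution
open Summit.ResolutionOfSingularities.ResolutionOfSingularities.Theses.PAlteration

/-! ## Glue: the thesis is the conjunction of the two cruxes -/

/-- The crux `PalterationThesis` (stmt-0552) is equivalent to the conjunction of the cruxes `Pialt`
(stmt-0555) and `Picover` (stmt-0554): the thesis is their prime-by-prime conjunction (pure logic).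
[folklore] -/
theorem palterationThesis_iff_pialt_and_picover : PalterationThesis ↔ Pialt ∧ Picover :=
  ⟨fun h => ⟨fun p hp k _ _ X f hs hl hq hi => (h p hp).1 k X f hs hl hq hi,
      fun p hp k _ _ Y X f g hs hl hq hY hreg hX hfin hui hsurj =>
        (h p hp).2 k Y X f g hs hl hq hY hreg hX hfin hui hsurj⟩,
    fun h p hp => ⟨fun k _ _ X f hs hl hq hi => h.1 p hp k X f hs hl hq hi,
      fun k _ _ Y X f g hs hl hq hY hreg hX hfin hui hsurj =>
        h.2 p hp k Y X f g hs hl hq hY hreg hX hfin hui hsurj⟩⟩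

/-- GLUE for item stmt-0552: the purely-inseparable-alteration conjecture `Pialt` (stmt-0555) and the
radicial-cover resolution statement `Picover` (stmt-0554) together give `PalterationThesis`.
[folklore] -/
theorem palterationThesis_of_pialt_of_picover (h₁ : Pialt) (h₂ : Picover) : PalterationThesis :=
  palterationThesis_iff_pialt_and_picover.2 ⟨h₁, h₂⟩

/-- Projection: `PalterationThesis` gives `Pialt` (stmt-0555). [folklore] -/
theorem pialt_of_palterationThesis (h : PalterationThesis) : Pialt :=
  (palterationThesis_iff_pialt_and_picover.1 h).1

/-- Projection: `PalterationThesis` gives `Picover` (stmt-0554). [folklore] -/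
theorem picover_of_palterationThesis (h : PalterationThesis) : Picover :=
  (palterationThesis_iff_pialt_and_picover.1 h).2

/-! ## Sandwich from above: the summit implies each conjunct -/

/-- `PICover_p` from resolution in characteristic `p`: a scheme `X` finite over a separated
finite-type `k`-scheme `Y` is itself separated and of finite type over `k` (finite morphisms are
affine, hence separated and quasi-compact, and locally of finite type), and an integral scheme is
reduced, so `ResolutionInChar p` applies to `X → Y → Spec k`. (The hypotheses that `Y` is integral
and regular and that `g` is radicial and surjective are not needed for this direction.)
[folklore] -/
theorem picoverAt_of_resolutionInChar {p : ℕ} (h : ResolutionInChar.{0} p) (k : Type) [Field k]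
    [CharP k p] (Y X : Scheme.{0}) (f : Y ⟶ Spec (.of k)) (g : X ⟶ Y) [IsSeparated f]
    [LocallyOfFiniteType f] [QuasiCompact f] [IsIntegral X] [IsFinite g] :
    Scheme.HasResolution X := by
  haveI : IsAffineHom g := inferInstance
  haveI : IsSeparated (g ≫ f) := inferInstance
  haveI : LocallyOfFiniteType (g ≫ f) := inferInstance
  haveI : QuasiCompact (g ≫ f) := inferInstance
  exact h k X (g ≫ f) inferInstance inferInstance inferInstance inferInstance

/-- `PIAlt_p` from resolution in characteristic `p` (Temkin 2013, §1 p. 3, (i) ⊂ (iii): a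
desingularisation of an integral `X` is a purely inseparable alteration with regular source — proper,
surjective, integral source, finite and radicial over the dense open where it is an isomorphism).
[cite: Temkin2013, §1 p. 3 (i), (iii)] -/
theorem pialtAt_of_resolutionInChar {p : ℕ} (h : ResolutionInChar.{0} p) (k : Type) [Field k]
    [CharP k p] (X : Scheme.{0}) (f : X ⟶ Spec (.of k)) [IsSeparated f] [LocallyOfFiniteType f]
    [QuasiCompact f] [IsIntegral X] :
    ∃ (X' : Scheme.{0}) (g : X' ⟶ X), IsProper g ∧ IsIntegral X' ∧ Scheme.IsRegular X' ∧
      Function.Surjective g.base ∧ ∃ U : X.Opens, Dense (U : Set X) ∧ IsFinite (g ∣_ U) ∧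
        UniversallyInjective (g ∣_ U) := by
  obtain ⟨X', g, hg, hreg⟩ := abramovichOort_of_resolutionInChar h k X f
  haveI : Surjective g := hg.surjective
  exact ⟨X', g, hg.isProper, hg.isIntegral, hreg, g.surjective, hg.exists_dense⟩

/-- The summit statement implies the crux `Picover` (stmt-0554). [folklore] -/
theorem picover_of_resolutionOfSingularities (h : _root_.ResolutionOfSingularities) : Picover := by
  intro p hp k _ _ Y X f g hs hl hq _hY _hreg hX hfin _hui _hsurj
  exact picoverAt_of_resolutionInChar (h p hp) k Y X f g

/-- The summit statement implies the crux `Pialt` (stmt-0555): resolution of singularities in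
positive characteristic implies the Abramovich–Oort conjecture in positive characteristic
(Temkin 2013, §1 p. 3). [cite: Temkin2013, §1 p. 3 (i), (iii)] -/
theorem pialt_of_resolutionOfSingularities (h : _root_.ResolutionOfSingularities) : Pialt := by
  intro p hp k _ _ X f hs hl hq hi
  exact pialtAt_of_resolutionInChar (h p hp) k X f

/-- SANDWICH: the summit statement `ResolutionOfSingularities` implies the crux `PalterationThesis`
(stmt-0552). With the route's deciding theorem (`PalterationThesis`, `PicoverToRadicialBottom`,
`DescentReducedToIntegral`, `Assembly2` ⊢ summit) the crux is therefore exactly summit-hard.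
[folklore] -/
theorem palterationThesis_of_resolutionOfSingularities (h : _root_.ResolutionOfSingularities) :
    PalterationThesis :=
  palterationThesis_of_pialt_of_picover (pialt_of_resolutionOfSingularities h)
    (picover_of_resolutionOfSingularities h)

end Summit.ResolutionOfSingularities.ResolutionOfSingularities.Theorems
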